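import Mathlib
import Summits.NavierStokesRegularity.NavierStokesRegularity.Theorems.EulerZoomLiouvillePowerGaugeEulerLiouvilleCondenserCircleMeanCore

/-!
# (P₀) THE PACKING VERSION OF THE CIRCULAR-MEAN CONDENSER CORE (nsreg-p2 g35 ROUND-45 «RAISING κ» §3, plate t47-P₀)

Width piece for crux `EulerZoomLiouville.PowerGaugeEulerLiouville` (stmt-NavierStokesRegularity-19832), by name under LEAD 19832
(ns-typeII-p2 g13); seat ns-ezl-w2 g4, `--supports stmt-NavierStokesRegularity-19832 --as helper`.  Text = nsreg-p2 g35's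
`r45/Sketch45.lean` Prop `NsregP2.R45.CircleMeanCondenserPacking` binder-for-binder.  `N = card S ≥ 1` centres with `ψ(p) ≥ m`,
pairwise `‖p − q‖ > 2r` (disjoint closed discs), `‖Dψ‖ ≤ G` on the discs, per-disc amplitude budget `A`, TOTAL energy `E` on the union:
EITHER `(1−δ)m ≤ √(2A/π)/r` OR `G ≥ (δm/r)·exp(N·2π((1−δ)m − √(2A/π)/r)²/E)` — the inner radius `w₀ = δm/G` is common to all discs and each
disjoint annulus `w₀ ≤ |z − p| ≤ r₁(p)` pays `2π(…)²/log(r/w₀)`.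

* `annulusEnergy_lower_of_core` — the per-disc capacity bound at the origin (the heart of t47-C `circleMeanCondenserCore_of`, re-packaged);
* `setIntegral_preimage_add_right` — translation of set integrals, `∫_{(·+p)⁻¹' T} f(z+p) = ∫_T f`;
* **`circleMeanCondenserPacking_of`**, `circleMeanCondenserPacking` — the packing dichotomy (`integral_biUnion_finset` over the disjoint annuli).

HONEST FRAMING: a lemma of real analysis in the plane; nothing here proves the crux E (19832 OPEN), any door Target, or any Navier–Stokes
statement; MODEL lattice only. [folklore (logarithmic capacity of an annulus; packing)]
-/

noncomputable section

open Set Filter Topology Metric Function MeasureTheory Real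

set_option linter.dupNamespace false

namespace Summit.NavierStokesRegularity.NavierStokesRegularity.Theorems.PowerGaugeEulerLiouville.Condenser

/-! ## The per-disc bound at the origin -/

/-- **PER-DISC CAPACITY BOUND (origin).**  Under the hypotheses of the circular-mean core with the first alternative EXCLUDED
(`√(2A/π)/r < (1−δ)m`): `G > 0`, and with `w₀ = δm/G` there is `r₁ ∈ [r/2, r]`, `w₀ < r₁`, whose annulus pays
`2π((1−δ)m − √(2A/π)/r)² ≤ log(r/w₀) · ∫_{w₀ ≤ |z| ≤ r₁} ‖Dψ‖²`. [folklore (logarithmic capacity of an annulus)] -/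
theorem annulusEnergy_lower_of_core {ψ : ℂ → ℝ} {m G A r δ : ℝ} (hψ : ContDiff ℝ 1 ψ) (hm : 0 < m) (hmψ : m ≤ ψ 0)
    (hr : 0 < r) (hδ : 0 < δ) (hG : ∀ z ∈ closedBall (0 : ℂ) r, ‖fderiv ℝ ψ z‖ ≤ G)
    (hA : ∫ z in closedBall (0 : ℂ) r, ψ z ^ 2 ≤ A) (hfirst : Real.sqrt (2 * A / π) / r < (1 - δ) * m) :
    0 < G ∧ ∃ r₁ ∈ Icc (r / 2) r, δ * m / G < r₁ ∧
      2 * π * ((1 - δ) * m - Real.sqrt (2 * A / π) / r) ^ 2 ≤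
        Real.log (r / (δ * m / G)) * ∫ z in {z : ℂ | δ * m / G ≤ ‖z‖ ∧ ‖z‖ ≤ r₁}, ‖fderiv ℝ ψ z‖ ^ 2 := by
  set B : ℝ := Real.sqrt (2 * A / π) / r with hB
  obtain ⟨r₁, hr₁, hmean₁⟩ := exists_circleAverage_le_of_sq_budget hψ.continuous hr (hm.trans_le hmψ) hA
  have hr₁pos : 0 < r₁ := by linarith [hr₁.1]
  have hGr : δ * m < G * r₁ := by
    by_contra hle
    push Not at hle
    have h1 := le_circleAverage_of_gradient_bound hψ hG hr₁pos.le hr₁.2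
    nlinarith
  have hGpos : 0 < G := by
    by_contra h; push Not at h
    have : G * r₁ ≤ 0 := mul_nonpos_of_nonpos_of_nonneg h hr₁pos.le
    nlinarith
  refine ⟨hGpos, r₁, hr₁, ?_, ?_⟩
  · rw [div_lt_iff₀ hGpos]; linarith
  set w₀ : ℝ := δ * m / G with hw₀
  have hw₀pos : 0 < w₀ := by rw [hw₀]; positivity
  have hw₀r₁ : w₀ < r₁ := by rw [hw₀, div_lt_iff₀ hGpos]; linarith
  have hmean₀ : (1 - δ) * m ≤ Real.circleAverage ψ 0 w₀ := by
    have h1 := le_circleAverage_of_gradient_bound hψ hG hw₀pos.le (hw₀r₁.le.trans hr₁.2)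
    have e : G * w₀ = δ * m := by rw [hw₀]; field_simp
    rw [e] at h1
    linarith
  have hcap := annulusEnergy_ge_circleAverage_amplitude hψ hw₀pos hw₀r₁
  have hlog : 0 < Real.log (r₁ / w₀) := Real.log_pos ((one_lt_div hw₀pos).2 hw₀r₁)
  have hD : (1 - δ) * m - B ≤ Real.circleAverage ψ 0 w₀ - Real.circleAverage ψ 0 r₁ := by linarith
  have hD0 : 0 ≤ (1 - δ) * m - B := by linarith
  have hI0 : 0 ≤ ∫ z in {z : ℂ | w₀ ≤ ‖z‖ ∧ ‖z‖ ≤ r₁}, ‖fderiv ℝ ψ z‖ ^ 2 := integral_nonneg fun z => sq_nonneg _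
  have h1 : 2 * π * ((1 - δ) * m - B) ^ 2 ≤ Real.log (r₁ / w₀) * ∫ z in {z : ℂ | w₀ ≤ ‖z‖ ∧ ‖z‖ ≤ r₁}, ‖fderiv ℝ ψ z‖ ^ 2 := by
    have h2 : 2 * π * ((1 - δ) * m - B) ^ 2 ≤ 2 * π * (Real.circleAverage ψ 0 w₀ - Real.circleAverage ψ 0 r₁) ^ 2 :=
      mul_le_mul_of_nonneg_left (pow_le_pow_left₀ hD0 hD 2) two_pi_pos.le
    have h3 := (div_le_iff₀ hlog).1 hcap
    linarith
  have hlogmono : Real.log (r₁ / w₀) ≤ Real.log (r / w₀) :=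
    Real.log_le_log (div_pos hr₁pos hw₀pos) (div_le_div_of_nonneg_right hr₁.2 hw₀pos.le)
  exact h1.trans (mul_le_mul_of_nonneg_right hlogmono hI0)

/-! ## Translation of set integrals -/

/-- **Translation of a set integral**: `∫_{(·+p)⁻¹' T} f(z + p) dz = ∫_T f` (Lebesgue measure on `ℂ` is translation invariant). [folklore] -/
theorem setIntegral_preimage_add_right (f : ℂ → ℝ) (p : ℂ) {T : Set ℂ} (hT : MeasurableSet T) :
    ∫ z in (fun z => z + p) ⁻¹' T, f (z + p) = ∫ z in T, f z := by
  have hTm : MeasurableSet ((fun z : ℂ => z + p) ⁻¹' T) := (measurable_id.add_const p) hT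
  rw [← integral_indicator hTm, ← integral_indicator hT]
  have e : (fun z => ((fun z : ℂ => z + p) ⁻¹' T).indicator (fun z => f (z + p)) z) = fun z => T.indicator f (z + p) := by
    funext z
    by_cases hz : z + p ∈ T
    · rw [indicator_of_mem (show z ∈ (fun z : ℂ => z + p) ⁻¹' T from hz), indicator_of_mem hz]
    · rw [indicator_of_notMem (show z ∉ (fun z : ℂ => z + p) ⁻¹' T from hz), indicator_of_notMem hz]
  rw [e]
  exact integral_add_right_eq_self (T.indicator f) p

/-! ## The packing dichotomy -/

/-- **(P₀) PACKING VERSION OF THE CIRCULAR-MEAN CONDENSER CORE.**  See the module docstring. [folklore (logarithmic capacity; packing)] -/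
theorem circleMeanCondenserPacking_of {ψ : ℂ → ℝ} {S : Finset ℂ} {m G A E r δ : ℝ} (hψ : ContDiff ℝ 1 ψ) (hS : S.Nonempty)
    (hm : 0 < m) (hr : 0 < r) (hδ : 0 < δ) (hE : 0 < E)
    (hmS : ∀ p ∈ S, m ≤ ψ p)
    (hsep : ∀ p ∈ S, ∀ q ∈ S, p ≠ q → 2 * r < ‖p - q‖)
    (hG : ∀ p ∈ S, ∀ z ∈ closedBall p r, ‖fderiv ℝ ψ z‖ ≤ G)
    (hA : ∀ p ∈ S, ∫ z in closedBall p r, ψ z ^ 2 ≤ A)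
    (hEn : ∫ z in ⋃ p ∈ S, closedBall p r, ‖fderiv ℝ ψ z‖ ^ 2 ≤ E) :
    (1 - δ) * m ≤ Real.sqrt (2 * A / π) / r ∨
      δ * m / r * Real.exp (S.card * (2 * π * ((1 - δ) * m - Real.sqrt (2 * A / π) / r) ^ 2) / E) ≤ G := by
  classical
  set B : ℝ := Real.sqrt (2 * A / π) / r with hB
  by_cases hfirst : (1 - δ) * m ≤ B
  · exact Or.inl hfirst
  right
  push Not at hfirst
  set D2 : ℝ := 2 * π * ((1 - δ) * m - B) ^ 2 with hD2
  -- the translated profile at each centre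
  have hcore : ∀ p ∈ S, 0 < G ∧ ∃ r₁ ∈ Icc (r / 2) r, δ * m / G < r₁ ∧
      D2 ≤ Real.log (r / (δ * m / G)) * ∫ z in {z : ℂ | δ * m / G ≤ ‖z - p‖ ∧ ‖z - p‖ ≤ r₁}, ‖fderiv ℝ ψ z‖ ^ 2 := by
    intro p hp
    set ψp : ℂ → ℝ := fun z => ψ (z + p) with hψp
    have hψpC : ContDiff ℝ 1 ψp := hψ.comp (contDiff_id.add contDiff_const)
    have hDψp : ∀ z, fderiv ℝ ψp z = fderiv ℝ ψ (z + p) := fun z => fderiv_comp_add_right p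
    have hψp0 : m ≤ ψp 0 := by simp only [hψp, zero_add]; exact hmS p hp
    have hGp : ∀ z ∈ closedBall (0 : ℂ) r, ‖fderiv ℝ ψp z‖ ≤ G := by
      intro z hz
      rw [hDψp]
      refine hG p hp (z + p) ?_
      rw [mem_closedBall, dist_eq_norm, add_sub_cancel_right]; exact mem_closedBall_zero_iff.1 hz
    have hpre : ∀ {T : Set ℂ}, (fun z : ℂ => z + p) ⁻¹' ((fun z => z - p) ⁻¹' T) = T := by
      intro T; ext z; simp
    have hAp : ∫ z in closedBall (0 : ℂ) r, ψp z ^ 2 ≤ A := by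
      have e : closedBall (0 : ℂ) r = (fun z : ℂ => z + p) ⁻¹' (closedBall p r) := by
        ext z; simp [mem_closedBall, dist_eq_norm]
      rw [e, setIntegral_preimage_add_right (fun z => ψ z ^ 2) p measurableSet_closedBall]
      exact hA p hp
    obtain ⟨hGpos, r₁, hr₁, hw, hcap⟩ := annulusEnergy_lower_of_core hψpC hm hψp0 hr hδ hGp hAp hfirst
    refine ⟨hGpos, r₁, hr₁, hw, ?_⟩
    have hTm : MeasurableSet {z : ℂ | δ * m / G ≤ ‖z - p‖ ∧ ‖z - p‖ ≤ r₁} :=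
      (measurableSet_le measurable_const (continuous_norm.comp (continuous_id.sub continuous_const)).measurable).inter
        (measurableSet_le (continuous_norm.comp (continuous_id.sub continuous_const)).measurable measurable_const)
    have e : {z : ℂ | δ * m / G ≤ ‖z‖ ∧ ‖z‖ ≤ r₁} = (fun z : ℂ => z + p) ⁻¹' {z : ℂ | δ * m / G ≤ ‖z - p‖ ∧ ‖z - p‖ ≤ r₁} := by
      ext z; simp
    have e2 : ∫ z in {z : ℂ | δ * m / G ≤ ‖z‖ ∧ ‖z‖ ≤ r₁}, ‖fderiv ℝ ψp z‖ ^ 2 =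
        ∫ z in {z : ℂ | δ * m / G ≤ ‖z - p‖ ∧ ‖z - p‖ ≤ r₁}, ‖fderiv ℝ ψ z‖ ^ 2 := by
      rw [e]
      simp only [hDψp]
      exact setIntegral_preimage_add_right (fun z => ‖fderiv ℝ ψ z‖ ^ 2) p hTm
    rw [← e2]; exact hcap
  obtain ⟨p₀, hp₀⟩ := hS
  have hGpos : 0 < G := (hcore p₀ hp₀).1
  set w₀ : ℝ := δ * m / G with hw₀
  have hw₀pos : 0 < w₀ := by rw [hw₀]; positivity
  -- choose the outer radii
  choose! r₁ hr₁ hw hcapp using fun p hp => (hcore p hp).2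
  -- the annuli are disjoint, measurable, inside the discs
  set ann : ℂ → Set ℂ := fun p => {z : ℂ | w₀ ≤ ‖z - p‖ ∧ ‖z - p‖ ≤ r₁ p} with hann
  have hannm : ∀ p, MeasurableSet (ann p) := fun p =>
    (measurableSet_le measurable_const (continuous_norm.comp (continuous_id.sub continuous_const)).measurable).inter
      (measurableSet_le (continuous_norm.comp (continuous_id.sub continuous_const)).measurable measurable_const)
  have hannsub : ∀ p ∈ S, ann p ⊆ closedBall p r := fun p hp z hz => by
    rw [mem_closedBall, dist_eq_norm]; exact hz.2.trans (hr₁ p hp).2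
  have hdisj : Set.Pairwise (↑S : Set ℂ) (Disjoint on ann) := by
    intro p hp q hq hpq
    rw [Function.onFun, Set.disjoint_left]
    intro z hzp hzq
    have h1 : ‖z - p‖ ≤ r := (hzp.2).trans (hr₁ p hp).2
    have h2 : ‖z - q‖ ≤ r := (hzq.2).trans (hr₁ q hq).2
    have h3 := hsep p hp q hq hpq
    have h4 : ‖p - q‖ ≤ ‖z - p‖ + ‖z - q‖ := by
      calc ‖p - q‖ = ‖(z - q) - (z - p)‖ := by congr 1; abel
        _ ≤ ‖z - q‖ + ‖z - p‖ := norm_sub_le _ _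
        _ = ‖z - p‖ + ‖z - q‖ := add_comm _ _
    linarith
  have hEc : Continuous fun z => ‖fderiv ℝ ψ z‖ ^ 2 := ((hψ.continuous_fderiv one_ne_zero).norm).pow 2
  have hintU : IntegrableOn (fun z => ‖fderiv ℝ ψ z‖ ^ 2) (⋃ p ∈ S, closedBall p r) volume :=
    hEc.continuousOn.integrableOn_compact (S.isCompact_biUnion fun p _ => isCompact_closedBall p r)
  have hsum : ∑ p ∈ S, ∫ z in ann p, ‖fderiv ℝ ψ z‖ ^ 2 ≤ E := by
    have hsubU : ∀ p ∈ S, ann p ⊆ ⋃ q ∈ S, closedBall q r := fun p hp z hz =>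
      Set.mem_iUnion₂.2 ⟨p, hp, hannsub p hp hz⟩
    rw [← integral_biUnion_finset S (fun p _ => hannm p) hdisj (fun p hp => hintU.mono_set (hsubU p hp))]
    refine (setIntegral_mono_set hintU (Eventually.of_forall fun z => sq_nonneg _) (Eventually.of_forall ?_)).trans hEn
    exact iUnion₂_subset fun p hp => hsubU p hp
  -- sum the per-disc bounds
  have hlogpos : 0 < Real.log (r / w₀) := by
    have hw₀r : w₀ < r := (hw p₀ hp₀).trans_le (hr₁ p₀ hp₀).2
    exact Real.log_pos ((one_lt_div hw₀pos).2 hw₀r)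
  have hN : (S.card : ℝ) * D2 ≤ Real.log (r / w₀) * E := by
    calc (S.card : ℝ) * D2 = ∑ p ∈ S, D2 := by rw [Finset.sum_const, nsmul_eq_mul]
      _ ≤ ∑ p ∈ S, Real.log (r / w₀) * ∫ z in ann p, ‖fderiv ℝ ψ z‖ ^ 2 := Finset.sum_le_sum fun p hp => hcapp p hp
      _ = Real.log (r / w₀) * ∑ p ∈ S, ∫ z in ann p, ‖fderiv ℝ ψ z‖ ^ 2 := by rw [Finset.mul_sum]
      _ ≤ Real.log (r / w₀) * E := mul_le_mul_of_nonneg_left hsum hlogpos.le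
  have h4 : (S.card : ℝ) * D2 / E ≤ Real.log (r / w₀) := by
    rw [div_le_iff₀ hE]; linarith
  have h5 : Real.exp ((S.card : ℝ) * D2 / E) ≤ r / w₀ := by
    rw [← Real.exp_log (div_pos hr hw₀pos)]; exact Real.exp_le_exp.2 h4
  have e : r / w₀ = r * G / (δ * m) := by rw [hw₀]; field_simp
  rw [e, le_div_iff₀ (by positivity)] at h5
  rw [div_mul_eq_mul_div, div_le_iff₀ hr]
  nlinarith [h5]

/-- **`NsregP2.R45.CircleMeanCondenserPacking`, binder-for-binder** (Sketch45 of nsreg-p2 g35, plate t47-P₀).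
[folklore (logarithmic capacity; packing)] -/
theorem circleMeanCondenserPacking :
    ∀ (ψ : ℂ → ℝ) (S : Finset ℂ) (m G A E r δ : ℝ), ContDiff ℝ 1 ψ → S.Nonempty → 0 < m → 0 < r → 0 < δ → δ < 1 →
      0 < E →
      (∀ p ∈ S, m ≤ ψ p) →
      (∀ p ∈ S, ∀ q ∈ S, p ≠ q → 2 * r < ‖p - q‖) →
      (∀ p ∈ S, ∀ z ∈ closedBall p r, ‖fderiv ℝ ψ z‖ ≤ G) →
      (∀ p ∈ S, ∫ z in closedBall p r, ψ z ^ 2 ≤ A) →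
      (∫ z in ⋃ p ∈ S, closedBall p r, ‖fderiv ℝ ψ z‖ ^ 2 ≤ E) →
      (1 - δ) * m ≤ Real.sqrt (2 * A / Real.pi) / r ∨
        δ * m / r * Real.exp (S.card * (2 * Real.pi * ((1 - δ) * m - Real.sqrt (2 * A / Real.pi) / r) ^ 2) / E) ≤ G :=
  fun _ _ _ _ _ _ _ _ hψ hS hm hr hδ _ hE hmS hsep hG hA hEn => circleMeanCondenserPacking_of hψ hS hm hr hδ hE hmS hsep hG hA hEn

end Summit.NavierStokesRegularity.NavierStokesRegularity.Theorems.PowerGaugeEulerLiouville.Condenser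

end
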